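import Mathlib
import HarnessLib
import Literature.MathematicalPhysics.QuantumFieldTheory.ConstructiveQFTWave0
import Literature.MathematicalPhysics.QuantumLattice.GaugeGroups
import Literature.MathematicalPhysics.QuantumFieldTheory.Balaban1983to89.B10

/-!
# `Balaban1983to89.B10Eq6PartitionLower` — [Balaban1985UV3] p. 257, remark **(6)**, the LOWER half:
# *"The bounds (5) imply bounds for partition functions, i.e. for the integrals ∫dUρ_k(U), hence by normalization
# identities  ∫dUρ_k = ∫dUT^kρ₀ = ∫dUρ₀ = Z^ε  (6)  they imply uniform in ε bounds for the partition function Z^ε."*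

T. Bałaban, *Ultraviolet stability of three-dimensional lattice pure gauge field theories*, Commun. Math. Phys. **102**,
255–275 (1985) [Balaban1985UV3] (cell paper B10; journal page = PDF page + 254; pp. 256–257 re-read on the renders
`run/shared/lean/pub/pub-balaban/b2b-balaban-ref1/pages/1985-cmp102-uv-stability-3d/…-p002-x2.png`, `…-p003-x2.png`,
2026-08-21).

HONEST FRAMING (mega-formalization `lit-balaban`, verbatim): statement-level skeleton of published theorems with
citation tags; proofs where landed; nothing here is a claim about the Yang–Mills mass gap.

WHY THIS FILE EXISTS.  Unit `lit-balaban-r07` (reader/typer of B10, fold owner), gen 7; SKELETON row B10.Eq6.  The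
row's head is `proved-existing`: the normalization identity ∫Tρ = ∫ρ of (6) is `…Balaban1983to89.Step.integral_RT_eq`
(density-RG carrier) and the UPPER half of the sentence *"(5) imply bounds for ∫dUρ_k"* is the three-line bookkeeping
`…B10.partition_upper` (ρ_K ≤ e^{c} pointwise ⇒ ∫ρ_K ≤ e^{c} for a normalised integral).  The LOWER half is not
bookkeeping: from the lower bound of (5) at the terminal scale, i.e. (3) p. 256 *"χ(U)e^{−O(1)|T_ε|} ≤ ρ_K(U)"*
(r07 gen 6, `…B10Ineq3Terminal.ineq3_of_bounds5At`), a lower bound on `Z^ε = ∫dUρ_K` needs the HAAR VOLUME of the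
small-field domain (4) *"|U(∂p) − 1| < ε₁, p ⊂ T₁^{(K)}"* on which χ = 1, and the observation that this volume does not
depend on ε.  Print leaves both to the reader (p. 257: *"we make only few remarks about the easier lower bound"*).  This
file supplies them on the CONCRETE torus carrier of the tree (`…QuantumFieldTheory.GaugeConfig d L G` = one group
element per positively oriented bond of `(ℤ/Lℤ)^d`, `plaquetteHolonomy`, normalised Haar measure `haarProbability G`,
product measure `Measure.pi`; instances for `U(N)`, `SU(N)` from `…QuantumLattice.GaugeGroups`).

THE ARGUMENT (ours; elementary).  Let `dev : G → ℝ` be any deviation-from-identity gauge with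
`dev(ab) ≤ dev a + dev b` and `dev(a⁻¹) ≤ dev a` (for `G ⊂ U(N)` and `dev u = ‖u − 1‖_op` both hold, §5).  Then
`dev U(∂p) ≤ Σ_{b∈∂p} dev U(b)` (`dev_plaquetteHolonomy_le`), so the bondwise-small set
`B_δ = {U : dev U(b) < δ ∀ b}` lies inside the domain (4) `P_{ε₁} = {U : dev U(∂p) < ε₁ ∀ p}` as soon as `4δ ≤ ε₁`
(`bondSmall_subset_plaqSmall`).  `B_δ` is a product set, so `(Π_b dU(b))(B_δ) = m_δ^{#bonds}` with `m_δ = Haar{dev < δ}`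
(`pi_bondSmall`), and `m_δ > 0` because `{dev < δ}` is an open neighbourhood of `1` and Haar measure charges open sets
(`haar_devLt_pos`).  Hence, if `e^{−c} ≤ ρ_K(U)` on `P_{ε₁}` (the lower half of (3)), then
`Z^ε = ∫dUρ_K ≥ e^{−c}·m_{ε₁/4}^{#bonds}` (`partition_lower`, `partition_lower_haar`), and with `#bonds = d·|T₁^{(K)}|`,
`|T₁^{(K)}| = ε₀^{−3}|T_ε|`, `c = O(1)|T_ε|` this is `Z^ε ≥ exp(−(O(1) + 3ε₀^{−3} log m⁻¹)|T_ε|)` at `d = 3`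
(`partition_lower_constant_eq`) — a bound *"uniform in ε"* because the terminal lattice `T₁^{(K)}` (side `ℓ/ε₀`,
`L^Kε = ε₀`), the window `ε₁` (at `k = K` the couplings are `g_K = gε₀^{1/2}`) and hence `m` do not involve ε at all.
The upper half on the same carrier is `partition_upper` (∫ρ_K ≤ e^{c}; product of probability measures).

DICTIONARY print ↦ Lean: `T₁^{(K)}` ↦ the torus `(ℤ/Lℤ)^d` of `GaugeConfig d L G` (here `L` is the number of sites per
side of the terminal unit lattice, `= ℓ/ε₀`; NOT the block size L of the paper); `U(∂p)` ↦ `plaquetteHolonomy U x i j`;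
`|U(∂p) − 1|` ↦ `dev (plaquetteHolonomy U x i j)` (for `G = U(N)`: `devU`, operator norm, the reading of
[Balaban1985Averaging] (19) used throughout the B10 files, cf. `…B10Eq11Trace.eq11_opNorm`); the domain (4) ↦
`plaqSmall dev ε₁`; `dU` ↦ `Measure.pi fun _ => haarProbability G`; `∫dUρ_K` ↦ `∫⁻ U, ENNReal.ofReal (ρK U) ∂…`
(lower Lebesgue integral, no integrability hypothesis) and `∫ U, ρK U ∂…` (Bochner, `integral_lower`).

WHAT THIS FILE PROVES (kernel, no `sorry`; definitions = the two sets `plaqSmall` (the domain (4)) / `bondSmall` and the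
deviations `devU` / `devSU` (+ the inclusion `toU`), theorems otherwise; no named facts; axioms standard): §1 integration
core (`mul_measure_le_lintegral`, `mul_measure_le_integral`, `lintegral_le_of_le`); §2 the deviation calculus on the
torus carrier (`dev_plaquetteHolonomy_le`, `bondSmall_subset_plaqSmall`, `bondSmall_eq_pi`; `#bonds = L^d·d` is
`…QuantumLattice.NarrowWell.card_edge`, recomputed inline);
§3 product measure (`pi_bondSmall`, `partition_lower`, `integral_lower`, `partition_upper`); §4 compact groups with Haar
measure (`measurableSet_devLt`, `haar_devLt_pos`, `partition_lower_haar`, `partition_lower_of_bounds5` — from (5) at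
`k = K` in the shape of `…B10.Bounds5At` with the [7]-regularity input of `…B10Ineq3Terminal`, `exp_neg_mul_pow_eq`,
`partition_lower_constant_eq`); §5 `G = U(N)` (`devU_mul_le`, `devU_inv`, `continuous_devU`,
`partition_lower_unitaryGroup`) and `G = SU(N)` (`devSU_mul_le`, `devSU_inv`, `partition_lower_specialUnitaryGroup`);
§6 (v1.1) the by-name edge to the cell's typed (5) `…B10.Bounds5At` at `k = K` (`partition_lower_of_Bounds5At`,
`partition_lower_of_Bounds5At_terminal` with `|T₁^{(K)}| = ε₀^{−3}|T_ε|`).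

Value = SKELETON row B10.Eq6 gains the lower half of its printed sentence at kernel level; NOT summit progress.
-/

noncomputable section

namespace Literature.MathematicalPhysics.QuantumFieldTheory.Balaban1983to89.B10Eq6PartitionLower

open _root_.MeasureTheory
open scoped ENNReal

/-! ## §1 Integration core (any measure space) -/

section Core

variable {X : Type*} [MeasurableSpace X]

/-- If `a ≤ f` on a measurable set `B`, then `a·μ(B) ≤ ∫⁻ f dμ` (lower Lebesgue integral of `ENNReal.ofReal ∘ f`; no
measurability of `f` needed).  The integration step of the lower half of remark (6). (elementary step of our proof
of the sentence) [cite: Balaban1985UV3, (6) p.257] -/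
theorem mul_measure_le_lintegral (μ : Measure X) {f : X → ℝ} {B : Set X} (hB : MeasurableSet B) {a : ℝ}
    (h : ∀ x ∈ B, a ≤ f x) :
    ENNReal.ofReal a * μ B ≤ ∫⁻ x, ENNReal.ofReal (f x) ∂μ := by
  calc ENNReal.ofReal a * μ B = ∫⁻ x, B.indicator (fun _ => ENNReal.ofReal a) x ∂μ := by
        rw [lintegral_indicator_const hB]
    _ ≤ ∫⁻ x, ENNReal.ofReal (f x) ∂μ := by
        refine lintegral_mono fun x => ?_
        by_cases hx : x ∈ B
        · rw [Set.indicator_of_mem hx]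
          exact ENNReal.ofReal_le_ofReal (h x hx)
        · rw [Set.indicator_of_notMem hx]
          exact zero_le

/-- If `f ≤ b` everywhere and `μ` is a probability measure, then `∫⁻ f dμ ≤ b` — the upper half of remark (6) on a
measure-theoretic carrier (the abstract-functional version is `…B10.partition_upper`). (elementary step of our proof
of the sentence) [cite: Balaban1985UV3, (6) p.257] -/
theorem lintegral_le_of_le (μ : Measure X) [IsProbabilityMeasure μ] {f : X → ℝ} {b : ℝ} (h : ∀ x, f x ≤ b) :
    ∫⁻ x, ENNReal.ofReal (f x) ∂μ ≤ ENNReal.ofReal b := by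
  calc ∫⁻ x, ENNReal.ofReal (f x) ∂μ ≤ ∫⁻ _x, ENNReal.ofReal b ∂μ :=
        lintegral_mono fun x => ENNReal.ofReal_le_ofReal (h x)
    _ = ENNReal.ofReal b := by rw [lintegral_const, measure_univ, mul_one]

/-- Bochner form of `mul_measure_le_lintegral`: for an integrable `f` with `a ≤ f` on `B` and `0 ≤ f` everywhere,
`a·μ(B) ≤ ∫ f dμ`. (elementary step of our proof of the sentence) [cite: Balaban1985UV3, (6) p.257] -/
theorem mul_measure_le_integral (μ : Measure X) [IsFiniteMeasure μ] {f : X → ℝ} (hf : Integrable f μ)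
    {B : Set X} (hB : MeasurableSet B) {a : ℝ} (h : ∀ x ∈ B, a ≤ f x) (h0 : ∀ x, 0 ≤ f x) :
    a * (μ B).toReal ≤ ∫ x, f x ∂μ := by
  have hind : ∫ x, B.indicator (fun _ => a) x ∂μ = a * (μ B).toReal := by
    rw [integral_indicator_const a hB, smul_eq_mul, mul_comm]
    rfl
  rw [← hind]
  refine integral_mono ((integrable_const a).indicator hB) hf fun x => ?_
  by_cases hx : x ∈ B
  · simp only [Set.indicator_of_mem hx]
    exact h x hx
  · simp only [Set.indicator_of_notMem hx]
    exact h0 x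

end Core

/-! ## §2 Deviation calculus on the torus carrier: the domain (4) contains a product set -/

section Deviation

variable {d L : ℕ} {G : Type*} [Group G] (dev : G → ℝ)

/-- The small-field domain **(4)** p. 256: *"|U(∂p) − 1| < ε₁, p ⊂ T₁^{(K)}"* — all plaquette variables of the
configuration `U` on the terminal unit torus deviate from `1` by less than `ε₁` (deviation gauge `dev`, e.g. the
operator norm `‖· − 1‖` for `G ⊂ U(N)`; all base points `x` and all direction pairs `(i, j)` — for `i = j` the
holonomy is `1`, and the two orientations of a plaquette have mutually inverse holonomies). The function χ of (3)/(5)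
is the characteristic function of this set. [cite: Balaban1985UV3, (4) p.256] -/
def plaqSmall (ε₁ : ℝ) : Set (GaugeConfig d L G) :=
  {U | ∀ (x : Site d L) (i j : Fin d), dev (plaquetteHolonomy U x i j) < ε₁}

/-- The bondwise-small set `{U : dev U(b) < δ for every bond b}` — a product of identical neighbourhoods of `1 ∈ G`,
one per bond; our device for bounding the Haar volume of (4) from below. (elementary; serves the domain (4) / remark
(6)) [cite: Balaban1985UV3, (4) p.256] -/
def bondSmall (δ : ℝ) : Set (GaugeConfig d L G) :=
  {U | ∀ e : Edge d L, dev (U e) < δ}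

/-- Unfolding of `plaqSmall`. (elementary; serves the domain (4) / remark (6)) [cite: Balaban1985UV3, (4) p.256] -/
theorem mem_plaqSmall {ε₁ : ℝ} {U : GaugeConfig d L G} :
    U ∈ plaqSmall dev ε₁ ↔ ∀ (x : Site d L) (i j : Fin d), dev (plaquetteHolonomy U x i j) < ε₁ := Iff.rfl

omit [Group G] in
/-- Unfolding of `bondSmall`. (elementary; serves the domain (4) / remark (6)) [cite: Balaban1985UV3, (4) p.256] -/
theorem mem_bondSmall {δ : ℝ} {U : GaugeConfig d L G} :
    U ∈ bondSmall dev δ ↔ ∀ e : Edge d L, dev (U e) < δ := Iff.rfl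

omit [Group G] in
/-- `bondSmall` is the product set `Π_b {g : dev g < δ}`. (elementary; serves the domain (4) / remark (6))
[cite: Balaban1985UV3, (4) p.256] -/
theorem bondSmall_eq_pi (δ : ℝ) :
    bondSmall (d := d) (L := L) dev δ = Set.univ.pi (fun _ : Edge d L => {g : G | dev g < δ}) := by
  ext U
  simp [bondSmall]

variable {dev}

/-- **Subadditivity along the plaquette boundary:** for a deviation gauge with `dev(ab) ≤ dev a + dev b` and
`dev(a⁻¹) ≤ dev a`, `dev U(∂p) ≤ Σ_{b ∈ ∂p} dev U(b)` (four bonds, two of them reversed). (elementary; serves the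
domain (4) / remark (6)) [cite: Balaban1985UV3, (4) p.256] -/
theorem dev_plaquetteHolonomy_le (hmul : ∀ a b : G, dev (a * b) ≤ dev a + dev b)
    (hinv : ∀ a : G, dev a⁻¹ ≤ dev a) (U : GaugeConfig d L G) (x : Site d L) (i j : Fin d) :
    dev (plaquetteHolonomy U x i j) ≤
      dev (U (x, i)) + dev (U (x.shift i, j)) + dev (U (x.shift j, i)) + dev (U (x, j)) := by
  unfold plaquetteHolonomy
  calc dev (U (x, i) * U (x.shift i, j) * (U (x.shift j, i))⁻¹ * (U (x, j))⁻¹)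
      ≤ dev (U (x, i) * U (x.shift i, j) * (U (x.shift j, i))⁻¹) + dev (U (x, j))⁻¹ := hmul _ _
    _ ≤ (dev (U (x, i) * U (x.shift i, j)) + dev (U (x.shift j, i))⁻¹) + dev (U (x, j))⁻¹ := by
        gcongr
        exact hmul _ _
    _ ≤ ((dev (U (x, i)) + dev (U (x.shift i, j))) + dev (U (x.shift j, i))) + dev (U (x, j)) := by
        gcongr
        · exact hmul _ _
        · exact hinv _
        · exact hinv _

/-- **The domain (4) contains the product set:** if every bond variable deviates from `1` by `< δ` and `4δ ≤ ε₁`,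
then every plaquette variable deviates by `< ε₁`. [cite: Balaban1985UV3, (4) p.256] -/
theorem bondSmall_subset_plaqSmall (hmul : ∀ a b : G, dev (a * b) ≤ dev a + dev b)
    (hinv : ∀ a : G, dev a⁻¹ ≤ dev a) {δ ε₁ : ℝ} (h4 : 4 * δ ≤ ε₁) :
    bondSmall (d := d) (L := L) dev δ ⊆ plaqSmall dev ε₁ := by
  intro U hU x i j
  have hp := dev_plaquetteHolonomy_le hmul hinv U x i j
  have h1 := hU (x, i)
  have h2 := hU (x.shift i, j)
  have h3 := hU (x.shift j, i)
  have h4' := hU (x, j)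
  linarith

end Deviation

/-! ## §3 Product measure: the volume of the product set and the lower bound for `∫dUρ_K` -/

section Product

variable {d L : ℕ} [NeZero L] {G : Type*} [Group G] [MeasurableSpace G] (μ : Measure G) [SigmaFinite μ]
  (dev : G → ℝ)

omit [Group G] in
/-- **Volume of the product set:** `(Π_b dμ)(bondSmall δ) = μ{dev < δ}^{#bonds}` (Mathlib `Measure.pi_pi`).
(elementary step of our proof of the sentence) [cite: Balaban1985UV3, (6) p.257] -/
theorem pi_bondSmall (δ : ℝ) :
    Measure.pi (fun _ : Edge d L => μ) (bondSmall (d := d) (L := L) dev δ) =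
      μ {g : G | dev g < δ} ^ Fintype.card (Edge d L) := by
  rw [bondSmall_eq_pi, Measure.pi_pi, Finset.prod_const, Finset.card_univ]

variable {μ dev}

/-- **Remark (6), lower half, product-measure form.**  If the density `ρ_K` on `T₁^{(K)} = (ℤ/Lℤ)^d` is `≥ e^{−c}` on the
small-field domain (4) `plaqSmall dev ε₁` — the lower bound of (3) p. 256, `χ(U)e^{−O(1)|T_ε|} ≤ ρ_K(U)` — then for any
`δ` with `4δ ≤ ε₁` and `{dev < δ}` measurable,
`e^{−c} · μ{dev < δ}^{#bonds} ≤ ∫dU ρ_K(U)` (`dU = Π_b dμ`, lower Lebesgue integral).  With (6)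
`∫dUρ_K = Z^ε` this is a lower bound for the partition function. [cite: Balaban1985UV3, (6) p.257] -/
theorem partition_lower (hmul : ∀ a b : G, dev (a * b) ≤ dev a + dev b) (hinv : ∀ a : G, dev a⁻¹ ≤ dev a)
    {δ ε₁ c : ℝ} (h4 : 4 * δ ≤ ε₁) (hS : MeasurableSet {g : G | dev g < δ})
    {ρK : GaugeConfig d L G → ℝ} (h3 : ∀ U ∈ plaqSmall (d := d) (L := L) dev ε₁, Real.exp (-c) ≤ ρK U) :
    ENNReal.ofReal (Real.exp (-c)) * μ {g : G | dev g < δ} ^ Fintype.card (Edge d L) ≤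
      ∫⁻ U, ENNReal.ofReal (ρK U) ∂(Measure.pi fun _ : Edge d L => μ) := by
  rw [← pi_bondSmall μ dev δ]
  have hB : MeasurableSet (bondSmall (d := d) (L := L) dev δ) := by
    rw [bondSmall_eq_pi]
    exact MeasurableSet.univ_pi fun _ => hS
  exact mul_measure_le_lintegral _ hB fun U hU => h3 U (bondSmall_subset_plaqSmall hmul hinv h4 hU)

/-- Bochner form of `partition_lower` for an integrable non-negative density (finite `μ`):
`e^{−c} · (μ{dev < δ}).toReal^{#bonds} ≤ ∫ ρ_K d(Π_b μ)`. [cite: Balaban1985UV3, (6) p.257] -/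
theorem integral_lower [IsFiniteMeasure μ] (hmul : ∀ a b : G, dev (a * b) ≤ dev a + dev b)
    (hinv : ∀ a : G, dev a⁻¹ ≤ dev a) {δ ε₁ c : ℝ} (h4 : 4 * δ ≤ ε₁) (hS : MeasurableSet {g : G | dev g < δ})
    {ρK : GaugeConfig d L G → ℝ} (hint : Integrable ρK (Measure.pi fun _ : Edge d L => μ))
    (h0 : ∀ U, 0 ≤ ρK U) (h3 : ∀ U ∈ plaqSmall (d := d) (L := L) dev ε₁, Real.exp (-c) ≤ ρK U) :
    Real.exp (-c) * ((μ {g : G | dev g < δ}).toReal) ^ Fintype.card (Edge d L) ≤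
      ∫ U, ρK U ∂(Measure.pi fun _ : Edge d L => μ) := by
  have hB : MeasurableSet (bondSmall (d := d) (L := L) dev δ) := by
    rw [bondSmall_eq_pi]
    exact MeasurableSet.univ_pi fun _ => hS
  have h := mul_measure_le_integral (Measure.pi fun _ : Edge d L => μ) hint hB
    (fun U hU => h3 U (bondSmall_subset_plaqSmall hmul hinv h4 hU)) h0
  rwa [pi_bondSmall μ dev δ, ENNReal.toReal_pow] at h

omit [Group G] [SigmaFinite μ] in
/-- **Remark (6), upper half, product-measure form** (companion of `…B10.partition_upper`): if `ρ_K ≤ e^{c}` pointwise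
(the upper bound of (3)) and `μ` is a probability measure, then `∫dUρ_K ≤ e^{c}`. [cite: Balaban1985UV3, (6) p.257] -/
theorem partition_upper [IsProbabilityMeasure μ] {c : ℝ} {ρK : GaugeConfig d L G → ℝ}
    (hup : ∀ U, ρK U ≤ Real.exp c) :
    ∫⁻ U, ENNReal.ofReal (ρK U) ∂(Measure.pi fun _ : Edge d L => μ) ≤ ENNReal.ofReal (Real.exp c) :=
  lintegral_le_of_le _ hup

end Product

/-! ## §4 Compact groups: Haar measure charges the window, and the ε-independent constant -/

section Haar

variable {d L : ℕ} [NeZero L] {G : Type*} [Group G] [TopologicalSpace G] [IsTopologicalGroup G] [CompactSpace G]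
  [MeasurableSpace G] [BorelSpace G] {dev : G → ℝ}

omit [Group G] [IsTopologicalGroup G] [CompactSpace G] in
/-- For a continuous deviation gauge the window `{dev < δ}` is open, hence Borel measurable. (elementary step of our
proof of the sentence) [cite: Balaban1985UV3, (6) p.257] -/
theorem measurableSet_devLt (hdev : Continuous dev) (δ : ℝ) : MeasurableSet {g : G | dev g < δ} :=
  (isOpen_lt hdev continuous_const).measurableSet

/-- **The window has positive Haar volume:** `{dev < δ}` is an open set containing `1` (`dev 1 < δ`), and the Haar
measure of a compact group charges every non-empty open set. (elementary step of our proof of the sentence)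
[cite: Balaban1985UV3, (6) p.257] -/
theorem haar_devLt_pos (hdev : Continuous dev) {δ : ℝ} (h1 : dev 1 < δ) :
    0 < haarProbability G {g : G | dev g < δ} := by
  haveI : (haarProbability G).IsHaarMeasure := by
    unfold haarProbability
    infer_instance
  exact (isOpen_lt hdev continuous_const).measure_pos (haarProbability G) ⟨1, h1⟩

/-- **Remark (6), lower half, for a compact gauge group with its normalised Haar measure** (the paper's `dU`): under the
lower bound of (3) on the domain (4), `e^{−c}·m^{#bonds} ≤ ∫dUρ_K` with `m = Haar{dev < ε₁/4} > 0`; `m` depends on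
`G`, `dev`, `ε₁` only — in particular NOT on the lattice spacing ε of the run that produced `ρ_K` (p. 257: *"uniform in ε
bounds for the partition function Z^ε"*). [cite: Balaban1985UV3, (6) p.257] -/
theorem partition_lower_haar (hdev : Continuous dev) (hmul : ∀ a b : G, dev (a * b) ≤ dev a + dev b)
    (hinv : ∀ a : G, dev a⁻¹ ≤ dev a) (h1 : dev 1 = 0) {ε₁ c : ℝ} (hε₁ : 0 < ε₁)
    {ρK : GaugeConfig d L G → ℝ} (h3 : ∀ U ∈ plaqSmall (d := d) (L := L) dev ε₁, Real.exp (-c) ≤ ρK U) :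
    0 < haarProbability G {g : G | dev g < ε₁ / 4} ∧
      ENNReal.ofReal (Real.exp (-c)) * haarProbability G {g : G | dev g < ε₁ / 4} ^ Fintype.card (Edge d L) ≤
        ∫⁻ U, ENNReal.ofReal (ρK U) ∂(Measure.pi fun _ : Edge d L => haarProbability G) :=
  ⟨haar_devLt_pos hdev (by rw [h1]; positivity),
    partition_lower hmul hinv (by linarith) (measurableSet_devLt hdev _) h3⟩

/-- **(5) at the terminal scale ⇒ the lower bound for `Z^ε = ∫dUρ_K`** (pp. 256–257), in the shape of
`…B10.Bounds5At` / `…B10Ineq3Terminal.ineq3_of_bounds5At`: if `χ = 1` on the domain (4), the lower bound of (5) at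
`k = K` holds pointwise — `χ(U)·exp[−g_K^{−2}A^η(U_K(U)) − O1·|T₁^{(K)}|] ≤ ρ_K(U)` — and on the domain (4) the
minimizer action satisfies `A^η(U_K(U)) ≤ a·|T₁^{(K)}|` (the [7]-regularity input `hreg` of `ineq3_of_bounds5At`), then
`exp(−(O1 + a·g_K^{−2})|T₁^{(K)}|)·m^{#bonds} ≤ ∫dUρ_K`, `m = Haar{dev < ε₁/4} > 0`.  Here `S` stands for `|T₁^{(K)}|`,
`A` for `U ↦ A^η(U_K(U))`, `gK` for `g_K`. [cite: Balaban1985UV3, (5) p.256, (6) p.257] -/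
theorem partition_lower_of_bounds5 (hdev : Continuous dev) (hmul : ∀ a b : G, dev (a * b) ≤ dev a + dev b)
    (hinv : ∀ a : G, dev a⁻¹ ≤ dev a) (h1 : dev 1 = 0) {ε₁ : ℝ} (hε₁ : 0 < ε₁)
    {χ A ρK : GaugeConfig d L G → ℝ} {gK O1 a S : ℝ}
    (hχ : ∀ U ∈ plaqSmall (d := d) (L := L) dev ε₁, χ U = 1)
    (h5 : ∀ U, χ U * Real.exp (-(gK⁻¹ ^ 2 * A U) - O1 * S) ≤ ρK U)
    (hreg : ∀ U ∈ plaqSmall (d := d) (L := L) dev ε₁, A U ≤ a * S) :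
    0 < haarProbability G {g : G | dev g < ε₁ / 4} ∧
      ENNReal.ofReal (Real.exp (-((O1 + a * gK⁻¹ ^ 2) * S))) *
          haarProbability G {g : G | dev g < ε₁ / 4} ^ Fintype.card (Edge d L) ≤
        ∫⁻ U, ENNReal.ofReal (ρK U) ∂(Measure.pi fun _ : Edge d L => haarProbability G) := by
  refine partition_lower_haar hdev hmul hinv h1 hε₁ (c := (O1 + a * gK⁻¹ ^ 2) * S) fun U hU => ?_
  have h := h5 U
  rw [hχ U hU, one_mul] at h
  refine le_trans (Real.exp_le_exp.mpr ?_) h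
  have hA := hreg U hU
  have hg : 0 ≤ gK⁻¹ ^ 2 := sq_nonneg _
  nlinarith [mul_le_mul_of_nonneg_left hA hg]

/-- `e^{−c}·m^k = exp(−(c + k·log m⁻¹))` for `m > 0`: the lower bound of `partition_lower_haar` as a single
exponential. (elementary step of our proof of the sentence) [cite: Balaban1985UV3, (6) p.257] -/
theorem exp_neg_mul_pow_eq {c m : ℝ} (hm : 0 < m) (k : ℕ) :
    Real.exp (-c) * m ^ k = Real.exp (-(c + k * Real.log m⁻¹)) := by
  rw [Real.log_inv, mul_neg, ← sub_eq_add_neg, neg_sub', sub_neg_eq_add, Real.exp_add, Real.exp_nat_mul,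
    Real.exp_log hm]

/-- **The ε-independent constant at `d = 3`** (p. 256: `|T₁^{(K)}| = (L^Kε)^{−3}|T_ε| = ε₀^{−3}|T_ε|` since
`L^Kε = ε₀`; `#bonds = 3|T₁^{(K)}|`): with `c = O1·|T_ε|` and `k = #bonds = 3ε₀^{−3}|T_ε|`,
`e^{−c}·m^k = exp(−(O1 + 3ε₀^{−3} log m⁻¹)·|T_ε|)` — the form *"e^{−O(1)|T_ε|} with a constant O(1) depending on g and ε₀
only"* of (3), now for `Z^ε`. [cite: Balaban1985UV3, (3) p.256, (6) p.257] -/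
theorem partition_lower_constant_eq {O1 Tε ε₀ m : ℝ} (hm : 0 < m) {k : ℕ} (hk : (k : ℝ) = 3 * (ε₀⁻¹ ^ 3 * Tε)) :
    Real.exp (-(O1 * Tε)) * m ^ k = Real.exp (-((O1 + 3 * ε₀⁻¹ ^ 3 * Real.log m⁻¹) * Tε)) := by
  rw [exp_neg_mul_pow_eq hm k, hk]
  ring_nf

end Haar

/-! ## §5 The paper's groups: `G = U(N)` and `G = SU(N)` with the operator-norm deviation `‖u − 1‖` -/

section Unitary

open scoped Matrix.Norms.L2Operator

variable {n : Type*} [Fintype n] [DecidableEq n]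

/-- The deviation `|u − 1|` of a unitary matrix from the identity in the operator norm ([Balaban1985Averaging] (19);
Mathlib's scoped `Matrix.Norms.L2Operator` norm, as in `…B10Eq11Trace.eq11_opNorm`). [cite: Balaban1985UV3, (4) p.256] -/
def devU (u : Matrix.unitaryGroup n ℂ) : ℝ := ‖(u : Matrix n n ℂ) - 1‖

/-- Unfolding of `devU`. (elementary; serves the domain (4) / remark (6)) [cite: Balaban1985UV3, (4) p.256] -/
theorem devU_apply (u : Matrix.unitaryGroup n ℂ) : devU u = ‖(u : Matrix n n ℂ) - 1‖ := rfl

/-- `|1 − 1| = 0`. (elementary; serves the domain (4) / remark (6)) [cite: Balaban1985UV3, (4) p.256] -/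
@[simp] theorem devU_one : devU (1 : Matrix.unitaryGroup n ℂ) = 0 := by
  simp [devU]

/-- **Subadditivity** `|uv − 1| ≤ |u − 1| + |v − 1|` for unitary `u`: `uv − 1 = u(v − 1) + (u − 1)` and
`‖u(v − 1)‖ = ‖v − 1‖` (`CStarRing.norm_coe_unitary_mul`). (elementary; serves the domain (4) / remark (6))
[cite: Balaban1985UV3, (4) p.256] -/
theorem devU_mul_le (u v : Matrix.unitaryGroup n ℂ) : devU (u * v) ≤ devU u + devU v := by
  simp only [devU]
  have h : ((u * v : Matrix.unitaryGroup n ℂ) : Matrix n n ℂ) - 1 =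
      (u : Matrix n n ℂ) * ((v : Matrix n n ℂ) - 1) + ((u : Matrix n n ℂ) - 1) := by
    rw [Submonoid.coe_mul, mul_sub, mul_one, sub_add_sub_cancel]
  rw [h]
  calc ‖(u : Matrix n n ℂ) * ((v : Matrix n n ℂ) - 1) + ((u : Matrix n n ℂ) - 1)‖
      ≤ ‖(u : Matrix n n ℂ) * ((v : Matrix n n ℂ) - 1)‖ + ‖(u : Matrix n n ℂ) - 1‖ := norm_add_le _ _
    _ = ‖(v : Matrix n n ℂ) - 1‖ + ‖(u : Matrix n n ℂ) - 1‖ := by rw [CStarRing.norm_coe_unitary_mul]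
    _ = ‖(u : Matrix n n ℂ) - 1‖ + ‖(v : Matrix n n ℂ) - 1‖ := add_comm _ _

/-- **Inversion invariance** `|u⁻¹ − 1| = |u − 1|`: `u⁻¹ = u*` and `‖(u − 1)*‖ = ‖u − 1‖`. (elementary; serves the
domain (4) / remark (6)) [cite: Balaban1985UV3, (4) p.256] -/
theorem devU_inv (u : Matrix.unitaryGroup n ℂ) : devU u⁻¹ = devU u := by
  simp only [devU]
  have h : ((u⁻¹ : Matrix.unitaryGroup n ℂ) : Matrix n n ℂ) = star (u : Matrix n n ℂ) := rfl
  have h' : star (u : Matrix n n ℂ) - 1 = star ((u : Matrix n n ℂ) - 1) := by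
    rw [star_sub, star_one]
  rw [h, h', norm_star]

/-- `devU` is continuous (subtype coercion, subtraction, norm). (elementary; serves the domain (4) / remark (6))
[cite: Balaban1985UV3, (4) p.256] -/
theorem continuous_devU : Continuous (devU (n := n)) :=
  (continuous_subtype_val.sub continuous_const).norm

/-- **Remark (6), lower half, for `G = U(N)`** (p. 257; `dU` = product of normalised Haar measures on the bonds of the
terminal unit torus `(ℤ/Lℤ)^d`, `|·|` = operator norm): if `e^{−c} ≤ ρ_K(U)` whenever `|U(∂p) − 1| < ε₁` for all
plaquettes (the lower bound of (3) on the domain (4)), then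
`0 < m := Haar{|u − 1| < ε₁/4}` and `e^{−c}·m^{#bonds} ≤ ∫dUρ_K (= Z^ε by (6))`, `#bonds = d·L^d`; nothing on the
right depends on the lattice spacing ε. [cite: Balaban1985UV3, (6) p.257] -/
theorem partition_lower_unitaryGroup {d L : ℕ} [NeZero L] {ε₁ c : ℝ} (hε₁ : 0 < ε₁)
    {ρK : GaugeConfig d L (Matrix.unitaryGroup n ℂ) → ℝ}
    (h3 : ∀ U ∈ plaqSmall (d := d) (L := L) devU ε₁, Real.exp (-c) ≤ ρK U) :
    0 < haarProbability (Matrix.unitaryGroup n ℂ) {u | devU u < ε₁ / 4} ∧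
      ENNReal.ofReal (Real.exp (-c)) *
          haarProbability (Matrix.unitaryGroup n ℂ) {u | devU u < ε₁ / 4} ^ (L ^ d * d) ≤
        ∫⁻ U, ENNReal.ofReal (ρK U) ∂(Measure.pi fun _ : Edge d L => haarProbability (Matrix.unitaryGroup n ℂ)) := by
  have h := partition_lower_haar (d := d) (L := L) continuous_devU devU_mul_le (fun u => (devU_inv u).le)
    devU_one hε₁ h3
  -- `#bonds = L^d·d` (`…QuantumLattice.NarrowWell.card_edge`, recomputed here to keep the import cone small)
  have hcard : Fintype.card (Edge d L) = L ^ d * d := by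
    simp [Fintype.card_prod, Fintype.card_pi, ZMod.card, Finset.prod_const, Fintype.card_fin]
  rwa [hcard] at h

/-- The deviation `|u − 1|` (operator norm) on `SU(N)`. [cite: Balaban1985UV3, (4) p.256] -/
def devSU (u : Matrix.specialUnitaryGroup n ℂ) : ℝ := ‖(u : Matrix n n ℂ) - 1‖

/-- Unfolding of `devSU`. (elementary; serves the domain (4) / remark (6)) [cite: Balaban1985UV3, (4) p.256] -/
theorem devSU_apply (u : Matrix.specialUnitaryGroup n ℂ) : devSU u = ‖(u : Matrix n n ℂ) - 1‖ := rfl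

/-- The inclusion `SU(N) → U(N)` as used here: an element of `SU(N)` is unitary. (elementary; serves the domain (4)
/ remark (6)) [cite: Balaban1985UV3, (4) p.256] -/
def toU (u : Matrix.specialUnitaryGroup n ℂ) : Matrix.unitaryGroup n ℂ :=
  ⟨(u : Matrix n n ℂ), (Matrix.mem_specialUnitaryGroup_iff.mp u.2).1⟩

/-- `toU` is the identity on matrices. (elementary; serves the domain (4) / remark (6))
[cite: Balaban1985UV3, (4) p.256] -/
@[simp] theorem coe_toU (u : Matrix.specialUnitaryGroup n ℂ) : ((toU u : Matrix.unitaryGroup n ℂ) : Matrix n n ℂ) = u :=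
  rfl

/-- `devSU = devU ∘ toU`. (elementary; serves the domain (4) / remark (6)) [cite: Balaban1985UV3, (4) p.256] -/
theorem devSU_eq (u : Matrix.specialUnitaryGroup n ℂ) : devSU u = devU (toU u) := rfl

/-- `toU` is multiplicative. (elementary; serves the domain (4) / remark (6)) [cite: Balaban1985UV3, (4) p.256] -/
theorem toU_mul (u v : Matrix.specialUnitaryGroup n ℂ) : toU (u * v) = toU u * toU v :=
  Subtype.ext rfl

/-- `toU` commutes with inversion. (elementary; serves the domain (4) / remark (6))
[cite: Balaban1985UV3, (4) p.256] -/
theorem toU_inv (u : Matrix.specialUnitaryGroup n ℂ) : toU u⁻¹ = (toU u)⁻¹ := by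
  apply Subtype.ext
  have h : toU u⁻¹ * toU u = 1 := by rw [← toU_mul, inv_mul_cancel]; rfl
  rw [eq_inv_of_mul_eq_one_left h]

/-- Subadditivity of `devSU` (from `devU_mul_le`). (elementary; serves the domain (4) / remark (6))
[cite: Balaban1985UV3, (4) p.256] -/
theorem devSU_mul_le (u v : Matrix.specialUnitaryGroup n ℂ) : devSU (u * v) ≤ devSU u + devSU v := by
  rw [devSU_eq, devSU_eq, devSU_eq, toU_mul]
  exact devU_mul_le _ _

/-- Inversion invariance of `devSU` (from `devU_inv`). (elementary; serves the domain (4) / remark (6))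
[cite: Balaban1985UV3, (4) p.256] -/
theorem devSU_inv (u : Matrix.specialUnitaryGroup n ℂ) : devSU u⁻¹ = devSU u := by
  rw [devSU_eq, devSU_eq, toU_inv, devU_inv]

/-- `devSU 1 = 0`. (elementary; serves the domain (4) / remark (6)) [cite: Balaban1985UV3, (4) p.256] -/
@[simp] theorem devSU_one : devSU (1 : Matrix.specialUnitaryGroup n ℂ) = 0 := by
  simp [devSU]

/-- `devSU` is continuous. (elementary; serves the domain (4) / remark (6)) [cite: Balaban1985UV3, (4) p.256] -/
theorem continuous_devSU : Continuous (devSU (n := n)) :=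
  (continuous_subtype_val.sub continuous_const).norm

/-- **Remark (6), lower half, for `G = SU(N)`** — the semisimple case of Theorem 1 (p. 257 *"with a semi-simple compact
group Lie G"*): same statement as `partition_lower_unitaryGroup`. [cite: Balaban1985UV3, (6) p.257] -/
theorem partition_lower_specialUnitaryGroup {d L : ℕ} [NeZero L] {ε₁ c : ℝ} (hε₁ : 0 < ε₁)
    {ρK : GaugeConfig d L (Matrix.specialUnitaryGroup n ℂ) → ℝ}
    (h3 : ∀ U ∈ plaqSmall (d := d) (L := L) devSU ε₁, Real.exp (-c) ≤ ρK U) :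
    0 < haarProbability (Matrix.specialUnitaryGroup n ℂ) {u | devSU u < ε₁ / 4} ∧
      ENNReal.ofReal (Real.exp (-c)) *
          haarProbability (Matrix.specialUnitaryGroup n ℂ) {u | devSU u < ε₁ / 4} ^ (L ^ d * d) ≤
        ∫⁻ U, ENNReal.ofReal (ρK U)
          ∂(Measure.pi fun _ : Edge d L => haarProbability (Matrix.specialUnitaryGroup n ℂ)) := by
  have h := partition_lower_haar (d := d) (L := L) continuous_devSU devSU_mul_le (fun u => (devSU_inv u).le)
    devSU_one hε₁ h3
  have hcard : Fintype.card (Edge d L) = L ^ d * d := by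
    simp [Fintype.card_prod, Fintype.card_pi, ZMod.card, Finset.prod_const, Fintype.card_fin]
  rwa [hcard] at h

end Unitary

/-! ## §6 (v1.1) By-name edge to the cell's typed (5): `B10.Bounds5At` at the terminal scale -/

section Bounds5

variable {d L : ℕ} [NeZero L] {G : Type*} [Group G] [TopologicalSpace G] [IsTopologicalGroup G] [CompactSpace G]
  [MeasurableSpace G] [BorelSpace G] {dev : G → ℝ}

/-- **(5) at `k = K`, BY NAME, ⇒ the lower bound for `Z^ε = ∫dUρ_K`** (pp. 256–257).  For a run `D : B10.RunData`
whose terminal configurations are identified with the concrete torus configurations by a map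
`ι : GaugeConfig d L G → D.Cfg D.K` (the identity when the carriers coincide), the cell's typed bounds (5) at the
terminal scale `B10.Bounds5At D O1 D.K`, the clause «χ_K = 1 on the domain (4)» (for the cell identification
χ(5)_K := χ_K(47) this is the inclusion (4) ⊂ (47)_K that [7] Thm 1 supplies for `ε₁ ≤ g_Kp(g_K)/B₃` — an INPUT here)
and the [7]-regularity input «A^η(U_K(U)) ≤ a·|T₁^{(K)}| on (4)» (the hypothesis `hreg` of
`…B10Ineq3Terminal.ineq3_of_bounds5At`) give
`exp(−(O1 + a·g_K^{−2})·|T₁^{(K)}|)·m^{#bonds} ≤ ∫dU ρ_K(ιU)`, `m = Haar{dev < ε₁/4} > 0` — with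
`|T₁^{(K)}| = ε₀^{−3}|T_ε|` the ε-uniform lower bound for the partition function of remark (6).
[cite: Balaban1985UV3, (5) p.256, (6) p.257] -/
theorem partition_lower_of_Bounds5At (D : B10.RunData) (ι : GaugeConfig d L G → D.Cfg D.K) {O1 : ℝ}
    (h5 : B10.Bounds5At D O1 D.K) (hdev : Continuous dev) (hmul : ∀ a b : G, dev (a * b) ≤ dev a + dev b)
    (hinv : ∀ a : G, dev a⁻¹ ≤ dev a) (h1 : dev 1 = 0) {ε₁ : ℝ} (hε₁ : 0 < ε₁) {a : ℝ}
    (hχ : ∀ U ∈ plaqSmall (d := d) (L := L) dev ε₁, D.χ D.K (ι U) = 1)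
    (hreg : ∀ U ∈ plaqSmall (d := d) (L := L) dev ε₁, D.wilsonBG D.K (ι U) ≤ a * D.sites D.K) :
    0 < haarProbability G {g : G | dev g < ε₁ / 4} ∧
      ENNReal.ofReal (Real.exp (-((O1 + a * (D.g D.K)⁻¹ ^ 2) * D.sites D.K))) *
          haarProbability G {g : G | dev g < ε₁ / 4} ^ Fintype.card (Edge d L) ≤
        ∫⁻ U, ENNReal.ofReal (D.ρ D.K (ι U)) ∂(Measure.pi fun _ : Edge d L => haarProbability G) :=
  partition_lower_of_bounds5 hdev hmul hinv h1 hε₁ (χ := fun U => D.χ D.K (ι U))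
    (A := fun U => D.wilsonBG D.K (ι U)) (ρK := fun U => D.ρ D.K (ι U)) hχ (fun U => (h5 (ι U)).1) hreg

/-- The same with the terminal data of p. 256 inserted (`|T₁^{(K)}| = ε₀^{−3}|T_ε|`, the hypothesis `hsites` of
`…B10Ineq3Terminal.ineq3_of_bounds5At`): the lower bound reads `exp(−ε₀^{−3}(O1 + a·g_K^{−2})·|T_ε|)·m^{#bonds}`, i.e.
(3)'s lower constant (`B10Ineq3Terminal`) times the ε-independent Haar volume factor. [cite: Balaban1985UV3, (3) p.256, (6) p.257] -/
theorem partition_lower_of_Bounds5At_terminal (D : B10.RunData) (ι : GaugeConfig d L G → D.Cfg D.K)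
    {O1 ε₀ Tε : ℝ} (hsites : D.sites D.K = ε₀⁻¹ ^ 3 * Tε)
    (h5 : B10.Bounds5At D O1 D.K) (hdev : Continuous dev) (hmul : ∀ a b : G, dev (a * b) ≤ dev a + dev b)
    (hinv : ∀ a : G, dev a⁻¹ ≤ dev a) (h1 : dev 1 = 0) {ε₁ : ℝ} (hε₁ : 0 < ε₁) {a : ℝ}
    (hχ : ∀ U ∈ plaqSmall (d := d) (L := L) dev ε₁, D.χ D.K (ι U) = 1)
    (hreg : ∀ U ∈ plaqSmall (d := d) (L := L) dev ε₁, D.wilsonBG D.K (ι U) ≤ a * D.sites D.K) :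
    ENNReal.ofReal (Real.exp (-((ε₀⁻¹ ^ 3 * (O1 + a * (D.g D.K)⁻¹ ^ 2)) * Tε))) *
        haarProbability G {g : G | dev g < ε₁ / 4} ^ Fintype.card (Edge d L) ≤
      ∫⁻ U, ENNReal.ofReal (D.ρ D.K (ι U)) ∂(Measure.pi fun _ : Edge d L => haarProbability G) := by
  have h := (partition_lower_of_Bounds5At D ι h5 hdev hmul hinv h1 hε₁ hχ hreg).2
  have hexp : (O1 + a * (D.g D.K)⁻¹ ^ 2) * D.sites D.K = (ε₀⁻¹ ^ 3 * (O1 + a * (D.g D.K)⁻¹ ^ 2)) * Tε := by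
    rw [hsites]; ring
  rwa [hexp] at h

end Bounds5

end Literature.MathematicalPhysics.QuantumFieldTheory.Balaban1983to89.B10Eq6PartitionLower

end
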